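import Mathlib
import Literature.Computability.AlgebraicComplexity.NewtonPolygonTau
import HarnessLib

/-!
# The τ-conjecture for Newton polygons (KPTT 2015) — proofs

Topic `Literature/Computability/AlgebraicComplexity`; sibling proof file of `NewtonPolygonTau.lean`
(which states Conjecture 1, its weak form, and Theorems 1, 5, 6 of P. Koiran, N. Portier,
S. Tavenas, S. Thomassé, *A τ-conjecture for Newton polygons*, Found. Comput. Math. 15 (2015)
185–197, arXiv:1308.2286, as named facts). Contents:

* `KPTT.theorem6_of_theorem5` — the printed proof of Theorem 6 (§4, three lines in print): Theorem 6
  (`O(k·t^{2m/3})` vertices for sums of `k` products of `m ≥ 2` `t`-sparse bivariate polynomials)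
  follows from Theorem 5 (`O(k(r^{2/3}s^{2/3} + r + s))` for sums of products of an `r`-sparse and
  an `s`-sparse polynomial) by splitting each product into two halves of `⌊m/2⌋` and `⌈m/2⌉`
  factors, which are `t^{⌊m/2⌋}`- and `t^{⌈m/2⌉}`-sparse, and absorbing `r + s ≤ 2·t^{2m/3}`
  (`⌈m/2⌉ ≤ 2m/3` for `m ≥ 2`) into the constant. Theorem 5 itself rests on the
  Eisenbrand–Pach–Rothvoß–Sopher bound for convexly independent subsets of Minkowski sums
  (KPTT Theorem 4, [EPRS08], proved via the crossing lemma) and stays the named fact `KPTT.theorem5`;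
  `theorem6_holds` is therefore exactly `theorem6_of_theorem5 theorem5_holds` once the latter lands.
* helpers: `card_support_prod_le` (support of a product of multivariate polynomials has at most
  `∏ #support` monomials), `card_support_prod_univ_le_pow`, and the exponent arithmetic
  `natCast_pow_le_rpow_two_mul_div_three` (`t^a ≤ t^{2m/3}` for `1 ≤ a`, `3a ≤ 2m`).
* `KPTT.newtonTauWeak_of_newtonTauConjecture` — Conjecture 1 (recorded as `(kmt+2)^C` vertices)
  implies the weak form `2^{a·m}(kt+2)^b` singled out after Theorem 1 (take `a = b = C`, using
  `m ≤ 2^m`); with the named fact `KPTT.theorem1` this gives the printed sentence "Conjecture 1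
  implies that the permanent is hard for arithmetic circuits" (§2, before Theorem 1) as
  `KPTT.not_isVPFamily_per_of_newtonTauConjecture`. Both `newtonTauConjecture` and `newtonTauWeak`
  are OPEN statements (KPTT §2, §5): these are implications between hypotheses, not discharges.

## References

* P. Koiran, N. Portier, S. Tavenas, S. Thomassé, Found. Comput. Math. 15 (2015) 185–197,
  arXiv:1308.2286: Theorems 5, 6 and the proof of Theorem 6 (§4) [KoiranPortierTavenasThomasse2015].
* F. Eisenbrand, J. Pach, T. Rothvoß, N. B. Sopher, *Convexly independent subsets of the Minkowski
  sum of planar point sets*, Electron. J. Combin. 15 (2008), Note 8 (= KPTT Theorem 4; not used here).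
-/

noncomputable section

namespace Literature.Computability.AlgebraicComplexity

open scoped BigOperators

namespace KPTT

/-! ### Theorem 6 from Theorem 5 (the printed proof of Theorem 6, §4)

KPTT prove Theorem 6 in three lines from Theorem 5: "we write each of the `k` products as a product
of two polynomials `F_i = Π_{j ≤ ⌈m/2⌉} f_ij` and `G_i = Π_{j > ⌈m/2⌉} f_ij`. We can now apply
Theorem 5 to `f = Σ_i F_i G_i`, with `r = t^{⌈m/2⌉}` and `s = t^{⌊m/2⌋}`. In the resulting
`O(k(r^{2/3}s^{2/3} + r + s))` upper bound the term `k r^{2/3} s^{2/3}` dominates since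
`r^{2/3}s^{2/3} = t^{2(⌈m/2⌉ + ⌊m/2⌋)/3} = t^{2m/3}` and `m ≥ 2`."
[cite: KoiranPortierTavenasThomasse2015, proof of Theorem 6]. This reduction is formalized below
as `theorem6_of_theorem5`; Theorem 5 itself (which rests on the Eisenbrand–Pach–Rothvoß–Sopher
bound for convexly independent subsets of Minkowski sums, KPTT Theorem 4) is the named fact
`theorem5` above. -/

/-- The support of a finite product of multivariate polynomials has at most `∏ #support` elements
(iterating `MvPolynomial.support_mul : (p * q).support ⊆ p.support + q.support`). [folklore] -/
theorem card_support_prod_le {K : Type*} [CommSemiring K] [Nontrivial K] {σ ι : Type*}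
    [DecidableEq σ] (s : Finset ι) (g : ι → MvPolynomial σ K) :
    (∏ j ∈ s, g j).support.card ≤ ∏ j ∈ s, (g j).support.card := by
  classical
  open scoped Pointwise in
  induction s using Finset.induction_on with
  | empty => simp [MvPolynomial.support_one]
  | insert a s ha ih =>
    rw [Finset.prod_insert ha, Finset.prod_insert ha]
    calc (g a * ∏ j ∈ s, g j).support.card
        ≤ ((g a).support + (∏ j ∈ s, g j).support).card :=
          Finset.card_le_card (MvPolynomial.support_mul _ _)
      _ ≤ (g a).support.card * (∏ j ∈ s, g j).support.card := Finset.card_add_le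
      _ ≤ (g a).support.card * ∏ j ∈ s, (g j).support.card := Nat.mul_le_mul_left _ ih

/-- A product of `t`-sparse polynomials indexed by `Fin a` is `t ^ a`-sparse. [folklore] -/
theorem card_support_prod_univ_le_pow {K : Type*} [CommSemiring K] [Nontrivial K] {σ : Type*}
    [DecidableEq σ] {a t : ℕ} (g : Fin a → MvPolynomial σ K)
    (hg : ∀ j, (g j).support.card ≤ t) :
    (∏ j, g j).support.card ≤ t ^ a := by
  calc (∏ j, g j).support.card ≤ ∏ j, (g j).support.card := card_support_prod_le _ _
    _ ≤ t ^ (Finset.univ : Finset (Fin a)).card :=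
        Finset.prod_le_pow_card _ _ _ fun j _ => hg j
    _ = t ^ a := by rw [Finset.card_univ, Fintype.card_fin]

/-- For naturals `t` and `1 ≤ a` with `3a ≤ 2m`: `t ^ a ≤ t ^ (2m/3)` as reals (both sides vanish at
`t = 0`). The arithmetic behind "the term `k r^{2/3}s^{2/3}` dominates" in the proof of Theorem 6. [folklore] -/
theorem natCast_pow_le_rpow_two_mul_div_three {t a m : ℕ} (ha : 1 ≤ a) (ham : 3 * a ≤ 2 * m) :
    ((t ^ a : ℕ) : ℝ) ≤ (t : ℝ) ^ (2 * (m : ℝ) / 3) := by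
  rcases Nat.eq_zero_or_pos t with rfl | ht
  · have : ((0 ^ a : ℕ) : ℝ) = 0 := by
      rw [Nat.cast_pow, Nat.cast_zero]; exact zero_pow (by omega)
    rw [this]
    exact Real.rpow_nonneg (Nat.cast_nonneg _) _
  · have ht1 : (1 : ℝ) ≤ (t : ℝ) := by exact_mod_cast ht
    rw [Nat.cast_pow, ← Real.rpow_natCast]
    refine Real.rpow_le_rpow_of_exponent_le ht1 ?_
    have : ((3 * a : ℕ) : ℝ) ≤ ((2 * m : ℕ) : ℝ) := by exact_mod_cast ham
    push_cast at this
    linarith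

/-- **KPTT 2015, Theorem 6 from Theorem 5** — the printed proof of Theorem 6 (§4): split each
product `Π_{j<m} f_ij` into `F_i = Π_{j < ⌊m/2⌋} f_ij` and `G_i = Π_{j ≥ ⌊m/2⌋} f_ij`, which are
`t^{⌊m/2⌋}`- and `t^{⌈m/2⌉}`-sparse, apply Theorem 5 with `r = t^{⌊m/2⌋}`, `s = t^{⌈m/2⌉}`, and
absorb `r + s ≤ 2 t^{2m/3}` (valid as `⌈m/2⌉ ≤ 2m/3` for `m ≥ 2`) into the constant:
`C₆ = 3 · max(C₅, 1)`. [cite: KoiranPortierTavenasThomasse2015, Theorem 6 and its proof] -/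
theorem theorem6_of_theorem5 (h5 : theorem5) : theorem6 := by
  classical
  obtain ⟨C, hC⟩ := h5
  refine ⟨3 * max C 1, ?_⟩
  intro K _ k m t f hm ht
  -- split `m = a + b` into two halves, each of size `≥ 1` and `≤ 2m/3`
  obtain ⟨a, b, rfl, ha, hb, ha3, hb3⟩ :
      ∃ a b : ℕ, m = a + b ∧ 1 ≤ a ∧ 1 ≤ b ∧ 3 * a ≤ 2 * (a + b) ∧ 3 * b ≤ 2 * (a + b) :=
    ⟨m / 2, m - m / 2, by omega, by omega, by omega, by omega, by omega⟩
  set F : Fin k → MvPolynomial (Fin 2) K := fun i => ∏ j : Fin a, f i (Fin.castAdd b j) with hF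
  set G : Fin k → MvPolynomial (Fin 2) K := fun i => ∏ j : Fin b, f i (Fin.natAdd a j) with hG
  have hsplit : (∑ i, ∏ j, f i j) = ∑ i, F i * G i :=
    Finset.sum_congr rfl fun i _ => Fin.prod_univ_add (f i)
  have hFt : ∀ i, (F i).support.card ≤ t ^ a := fun i =>
    card_support_prod_univ_le_pow (fun j => f i (Fin.castAdd b j)) fun j => ht i _
  have hGt : ∀ i, (G i).support.card ≤ t ^ b := fun i =>
    card_support_prod_univ_le_pow (fun j => f i (Fin.natAdd a j)) fun j => ht i _
  have key := hC K k (t ^ a) (t ^ b) F G hFt hGt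
  -- the three terms of Theorem 5's bound against `T = t^{2m/3}`
  set T : ℝ := (t : ℝ) ^ (2 * ((a + b : ℕ) : ℝ) / 3) with hT
  have hT0 : 0 ≤ T := Real.rpow_nonneg (Nat.cast_nonneg _) _
  have h1 : ((t ^ a : ℕ) : ℝ) ^ (2 / 3 : ℝ) * ((t ^ b : ℕ) : ℝ) ^ (2 / 3 : ℝ) = T := by
    have t0 : (0 : ℝ) ≤ (t : ℝ) := Nat.cast_nonneg _
    rw [Nat.cast_pow, Nat.cast_pow, ← Real.rpow_natCast, ← Real.rpow_natCast,
      ← Real.rpow_mul t0, ← Real.rpow_mul t0, ← Real.rpow_add' t0]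
    · rw [hT]
      congr 1
      push_cast
      ring
    · have : (1 : ℝ) ≤ (a : ℝ) := by exact_mod_cast ha
      have : (0 : ℝ) ≤ (b : ℝ) := Nat.cast_nonneg _
      nlinarith
  have h2 : ((t ^ a : ℕ) : ℝ) ≤ T := natCast_pow_le_rpow_two_mul_div_three ha ha3
  have h3 : ((t ^ b : ℕ) : ℝ) ≤ T := natCast_pow_le_rpow_two_mul_div_three hb hb3
  have hX0 : 0 ≤ ((t ^ a : ℕ) : ℝ) ^ (2 / 3 : ℝ) * ((t ^ b : ℕ) : ℝ) ^ (2 / 3 : ℝ)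
      + ((t ^ a : ℕ) : ℝ) + ((t ^ b : ℕ) : ℝ) := by positivity
  have hC1 : C ≤ max C 1 := le_max_left _ _
  have hM0 : (0 : ℝ) ≤ max C 1 := le_trans zero_le_one (le_max_right _ _)
  rw [hsplit]
  calc (newtonVertexCount (∑ i, F i * G i) : ℝ)
      ≤ C * k * (((t ^ a : ℕ) : ℝ) ^ (2 / 3 : ℝ) * ((t ^ b : ℕ) : ℝ) ^ (2 / 3 : ℝ)
          + ((t ^ a : ℕ) : ℝ) + ((t ^ b : ℕ) : ℝ)) := key
    _ ≤ max C 1 * k * (((t ^ a : ℕ) : ℝ) ^ (2 / 3 : ℝ) * ((t ^ b : ℕ) : ℝ) ^ (2 / 3 : ℝ)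
          + ((t ^ a : ℕ) : ℝ) + ((t ^ b : ℕ) : ℝ)) := by
        rw [mul_assoc, mul_assoc]
        exact mul_le_mul_of_nonneg_right hC1 (by positivity)
    _ ≤ max C 1 * k * (T + T + T) := by
        refine mul_le_mul_of_nonneg_left ?_ (by positivity)
        rw [h1]
        linarith
    _ = 3 * max C 1 * k * T := by ring

/-! ### Theorem 5 from Theorem 4 (the printed proof of Theorem 5, §4)

KPTT's Theorem 4 is the Eisenbrand–Pach–Rothvoß–Sopher bound [EPRS08, Thm 1]: a convexly
independent subset `S` of the Minkowski sum `P + Q` of two finite planar point sets has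
`|S| = O(|P|^{2/3}|Q|^{2/3} + |P| + |Q|)`. It is not in the tree (its proof is the Pach–Sharir
incidence bound via the crossing lemma), so below it appears spelled out as the HYPOTHESIS of
`theorem5_of_minkowski_convexIndependent_bound`; the theorem is the rest of the printed proof of
Theorem 5: "Let `S_i` be the set of points in the plane corresponding to the monomials of `f_i g_i`
which appear in `f` with a nonzero coefficient. Since `Newt(f)` is the convex hull of `⋃_i S_i`, it
is enough to bound the number of vertices of `Newt(f)` lying in `S_i`. Those vertices form a
convexly independent subset of the Minkowski sum `Mon(f_i) + Mon(g_i)`. By Theorem 4, it follows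
that there are `O(r^{2/3}s^{2/3} + r + s)` of them. Multiplying this estimate by `k` yields an upper
bound on the number of vertices of `Newt(f)`." [cite: KoiranPortierTavenasThomasse2015, proof of Theorem 5] -/

open scoped Pointwise

/-- **KPTT 2015, Theorem 5 from Theorem 4 (= [EPRS08, Thm 1]).** If every convexly independent
subset `S ⊆ P + Q` of a Minkowski sum of finite planar point sets satisfies
`|S| ≤ C (|P|^{2/3}|Q|^{2/3} + |P| + |Q|)` (KPTT Theorem 4, the Eisenbrand–Pach–Rothvoß–Sopher
theorem, taken as hypothesis), then Theorem 5 holds (with constant `max C 0`): the vertices of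
`Newt(Σ_i f_i g_i)` all lie in `⋃_i (Mon f_i + Mon g_i)` (as `Mon(Σ_i f_i g_i) ⊆ ⋃_i Mon(f_i g_i)`
and `Mon(f_i g_i) ⊆ Mon f_i + Mon g_i`), and those lying in `Mon f_i + Mon g_i` form a convexly
independent set (a subset of the extreme points of the convex set `Newt`).
[cite: KoiranPortierTavenasThomasse2015, Theorem 5 and its proof; Theorem 4] -/
theorem theorem5_of_minkowski_convexIndependent_bound
    (H : ∃ C : ℝ, ∀ (P Q S : Finset (Fin 2 → ℝ)), S ⊆ P + Q →
      ConvexIndependent ℝ (Subtype.val : ↥(S : Set (Fin 2 → ℝ)) → (Fin 2 → ℝ)) →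
        (S.card : ℝ) ≤ C * ((P.card : ℝ) ^ (2 / 3 : ℝ) * (Q.card : ℝ) ^ (2 / 3 : ℝ)
          + P.card + Q.card)) :
    theorem5 := by
  classical
  obtain ⟨C, hC⟩ := H
  refine ⟨max C 0, ?_⟩
  intro K _ k r s f g hf hg
  dsimp only [newtonVertexCount]
  -- the embedding `ℕ² ↪ ℝ²` of exponent vectors, and the polynomial `F = Σ f_i g_i`
  set ι : (Fin 2 →₀ ℕ) → (Fin 2 → ℝ) := fun e : Fin 2 →₀ ℕ => fun i : Fin 2 => ((e i : ℕ) : ℝ)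
    with hι
  have hιadd : ∀ a b : Fin 2 →₀ ℕ, ι (a + b) = ι a + ι b := by
    intro a b
    funext i
    simp [hι]
  obtain ⟨F, hF⟩ : ∃ F : MvPolynomial (Fin 2) K, ∑ i, f i * g i = F := ⟨_, rfl⟩
  rw [hF]
  -- `A = Mon(F) ⊆ ℝ²`, `V` = the vertices of `Newt(F) = conv A`
  set A : Finset (Fin 2 → ℝ) := F.support.image ι with hA
  set V : Set (Fin 2 → ℝ) := Set.extremePoints ℝ (convexHull ℝ (ι '' (F.support : Set _)))
    with hV
  have hAcoe : (A : Set (Fin 2 → ℝ)) = ι '' (F.support : Set _) := by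
    rw [hA, Finset.coe_image]
  have hVA : V ⊆ A := by
    rw [hAcoe]
    exact extremePoints_convexHull_subset
  have hVci : ConvexIndependent ℝ (Subtype.val : V → (Fin 2 → ℝ)) :=
    (convex_convexHull ℝ _).convexIndependent_extremePoints
  set VF : Finset (Fin 2 → ℝ) := A.filter (· ∈ V) with hVF
  have hVFcoe : (VF : Set (Fin 2 → ℝ)) = V := by
    ext x
    simp only [hVF, Finset.coe_filter, Set.mem_setOf_eq]
    exact ⟨fun h => h.2, fun h => ⟨hVA h, h⟩⟩
  have hcount : V.ncard = VF.card := by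
    rw [← hVFcoe, Set.ncard_coe_finset]
  -- `P i = Mon(f_i)`, `Q i = Mon(g_i)`, `W i` = the vertices lying in `P i + Q i`
  set P : Fin k → Finset (Fin 2 → ℝ) := fun i => (f i).support.image ι with hP
  set Q : Fin k → Finset (Fin 2 → ℝ) := fun i => (g i).support.image ι with hQ
  set W : Fin k → Finset (Fin 2 → ℝ) := fun i => VF.filter (· ∈ P i + Q i) with hW
  -- every vertex lies in some `P i + Q i`
  have hcover : VF ⊆ Finset.univ.biUnion W := by
    intro x hx
    have hxA : x ∈ A := (Finset.mem_filter.1 hx).1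
    obtain ⟨e, he, rfl⟩ := Finset.mem_image.1 hxA
    rw [← hF] at he
    obtain ⟨i, -, hi⟩ := Finset.mem_biUnion.1 (MvPolynomial.support_sum he)
    obtain ⟨a, ha, b, hb, rfl⟩ := Finset.mem_add.1 (MvPolynomial.support_mul _ _ hi)
    refine Finset.mem_biUnion.2 ⟨i, Finset.mem_univ _, Finset.mem_filter.2 ⟨hx, ?_⟩⟩
    rw [hιadd]
    exact Finset.add_mem_add (Finset.mem_image_of_mem _ ha) (Finset.mem_image_of_mem _ hb)
  -- Theorem 4 bounds each `W i`
  have hWle : ∀ i, ((W i).card : ℝ) ≤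
      max C 0 * ((r : ℝ) ^ (2 / 3 : ℝ) * (s : ℝ) ^ (2 / 3 : ℝ) + r + s) := by
    intro i
    have hsub : W i ⊆ P i + Q i := fun x hx => (Finset.mem_filter.1 hx).2
    have hci : ConvexIndependent ℝ
        (Subtype.val : ↥((W i : Finset (Fin 2 → ℝ)) : Set (Fin 2 → ℝ)) → (Fin 2 → ℝ)) := by
      refine hVci.mono fun x hx => ?_
      have hx' : x ∈ VF := (Finset.mem_filter.1 (Finset.mem_coe.1 hx)).1
      rw [← hVFcoe]
      exact Finset.mem_coe.2 hx'
    have h1 := hC (P i) (Q i) (W i) hsub hci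
    have hPr : ((P i).card : ℝ) ≤ r := by exact_mod_cast Finset.card_image_le.trans (hf i)
    have hQs : ((Q i).card : ℝ) ≤ s := by exact_mod_cast Finset.card_image_le.trans (hg i)
    have hX0 : 0 ≤ ((P i).card : ℝ) ^ (2 / 3 : ℝ) * ((Q i).card : ℝ) ^ (2 / 3 : ℝ)
        + (P i).card + (Q i).card := by positivity
    calc ((W i).card : ℝ)
        ≤ C * (((P i).card : ℝ) ^ (2 / 3 : ℝ) * ((Q i).card : ℝ) ^ (2 / 3 : ℝ)
            + (P i).card + (Q i).card) := h1
      _ ≤ max C 0 * (((P i).card : ℝ) ^ (2 / 3 : ℝ) * ((Q i).card : ℝ) ^ (2 / 3 : ℝ)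
            + (P i).card + (Q i).card) := mul_le_mul_of_nonneg_right (le_max_left _ _) hX0
      _ ≤ max C 0 * ((r : ℝ) ^ (2 / 3 : ℝ) * (s : ℝ) ^ (2 / 3 : ℝ) + r + s) := by
          refine mul_le_mul_of_nonneg_left ?_ (le_max_right _ _)
          gcongr
  -- sum over `i`
  have hsum : (VF.card : ℝ) ≤ ∑ i : Fin k, ((W i).card : ℝ) := by
    exact_mod_cast (Finset.card_le_card hcover).trans Finset.card_biUnion_le
  calc (V.ncard : ℝ) = VF.card := by rw [hcount]
    _ ≤ ∑ i : Fin k, ((W i).card : ℝ) := hsum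
    _ ≤ ∑ _i : Fin k, max C 0 * ((r : ℝ) ^ (2 / 3 : ℝ) * (s : ℝ) ^ (2 / 3 : ℝ) + r + s) :=
        Finset.sum_le_sum fun i _ => hWle i
    _ = max C 0 * k * ((r : ℝ) ^ (2 / 3 : ℝ) * (s : ℝ) ^ (2 / 3 : ℝ) + r + s) := by
        rw [Finset.sum_const, Finset.card_univ, Fintype.card_fin, nsmul_eq_mul]
        ring

/-- **KPTT 2015, Theorem 6 from Theorem 4 (= [EPRS08, Thm 1]).** Chaining the two printed
reductions: under the Eisenbrand–Pach–Rothvoß–Sopher bound for convexly independent subsets of a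
Minkowski sum (KPTT Theorem 4, taken as hypothesis exactly as in
`theorem5_of_minkowski_convexIndependent_bound`), Theorem 6 holds — Theorem 4 ⟹ Theorem 5
(`theorem5_of_minkowski_convexIndependent_bound`) ⟹ Theorem 6 (`theorem6_of_theorem5`). So the only
unformalized input to `theorem6` (and `theorem5`) is KPTT Theorem 4.
[cite: KoiranPortierTavenasThomasse2015, Theorems 4–6 and the proofs of Theorems 5–6 (§4)] -/
theorem theorem6_of_minkowski_convexIndependent_bound
    (H : ∃ C : ℝ, ∀ (P Q S : Finset (Fin 2 → ℝ)), S ⊆ P + Q →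
      ConvexIndependent ℝ (Subtype.val : ↥(S : Set (Fin 2 → ℝ)) → (Fin 2 → ℝ)) →
        (S.card : ℝ) ≤ C * ((P.card : ℝ) ^ (2 / 3 : ℝ) * (Q.card : ℝ) ^ (2 / 3 : ℝ)
          + P.card + Q.card)) :
    theorem6 :=
  theorem6_of_theorem5 (theorem5_of_minkowski_convexIndependent_bound H)

/-! ### Conjecture 1 implies the weak form consumed by Theorem 1 (§2)

KPTT, §2, immediately before Theorem 1: "Conjecture 1 implies that the permanent is hard for
arithmetic circuits. In fact, a significantly weaker bound on the number of edges would be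
sufficient" — and after it: "For instance, an upper bound of the form `2^{O(m)}(kt)^{O(1)}` would be
sufficient." In the recorded forms, Conjecture 1 (`newtonTauConjecture`, bound `(kmt+2)^C`) implies
the weak form (`newtonTauWeak`, bound `2^{a·m}(kt+2)^b`) with `a = b = C`, because `m ≤ 2^m` gives
`kmt + 2 ≤ (kt+2)·2^m`. Both statements are OPEN (KPTT §5 lists even the `k = 2` case of the weak
form as open); the theorems below are implications between hypotheses, not discharges. -/

/-- The arithmetic behind "a significantly weaker bound": `(kmt + 2)^C ≤ 2^{C·m}·(kt + 2)^C`
for all naturals, since `kmt + 2 ≤ (kt + 2)·2^m`. [folklore] -/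
theorem pow_kmt_le_two_pow_mul_pow (k m t C : ℕ) :
    (k * m * t + 2) ^ C ≤ 2 ^ (C * m) * (k * t + 2) ^ C := by
  have hm : m ≤ 2 ^ m := Nat.lt_two_pow_self.le
  have h0 : 1 ≤ 2 ^ m := Nat.one_le_two_pow
  have h1 : k * m * t ≤ k * t * 2 ^ m := by
    calc k * m * t = k * t * m := by ring
      _ ≤ k * t * 2 ^ m := Nat.mul_le_mul_left _ hm
  have h2 : 2 ≤ 2 * 2 ^ m := by omega
  have h3 : k * m * t + 2 ≤ (k * t + 2) * 2 ^ m := by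
    calc k * m * t + 2 ≤ k * t * 2 ^ m + 2 * 2 ^ m := add_le_add h1 h2
      _ = (k * t + 2) * 2 ^ m := by ring
  calc (k * m * t + 2) ^ C ≤ ((k * t + 2) * 2 ^ m) ^ C := Nat.pow_le_pow_left h3 C
    _ = 2 ^ (C * m) * (k * t + 2) ^ C := by
        rw [mul_pow, ← pow_mul, Nat.mul_comm m C]
        ring

/-- **KPTT 2015, §2: Conjecture 1 implies the weak form singled out after Theorem 1.** With the
recorded statements: `newtonTauConjecture` (at most `(kmt+2)^C` vertices) implies `newtonTauWeak`
(at most `2^{a·m}(kt+2)^b` vertices), taking `a = b = C` (`pow_kmt_le_two_pow_mul_pow`). Printed: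
"a significantly weaker bound on the number of edges would be sufficient … For instance, an upper
bound of the form `2^{O(m)}(kt)^{O(1)}` would be sufficient." Both sides are OPEN statements; this is
an implication between hypotheses. [cite: KoiranPortierTavenasThomasse2015, §2, Theorem 1 and the sentences around it] -/
theorem newtonTauWeak_of_newtonTauConjecture (h : newtonTauConjecture) : newtonTauWeak := by
  unfold newtonTauConjecture at h
  unfold newtonTauWeak
  obtain ⟨C, hC⟩ := h
  exact ⟨C, C, fun k m t f hf => (hC k m t f hf).trans (pow_kmt_le_two_pow_mul_pow k m t C)⟩

/-- **KPTT 2015, §2 (sentence before Theorem 1): "Conjecture 1 implies that the permanent is hard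
for arithmetic circuits."** In the tree's terms: from Theorem 1 (the named fact `theorem1`, taken as
hypothesis) and Conjecture 1 (`newtonTauConjecture`, OPEN, taken as hypothesis), the permanent
family `(per_n)_n` over `ℂ` is not a `VP` family. [cite: KoiranPortierTavenasThomasse2015, §2, sentence preceding Theorem 1] -/
theorem not_isVPFamily_per_of_newtonTauConjecture (h₁ : theorem1) (h : newtonTauConjecture) :
    ¬ IsVPFamily (fun n => perPoly (Fin n) ℂ) :=
  h₁ (newtonTauWeak_of_newtonTauConjecture h)

end KPTT

end Literature.Computability.AlgebraicComplexity
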